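import Summits.Parity.GeneralizedHardyLittlewood.Theorems.PrimeLevelFamEdgeIdeaDeltasPeterssonLayersBands
import Literature.NumberTheory.LFunctions.KMVCutoffWAfeWBridge
import Literature.NumberTheory.LFunctions.KMVHeckeRecursionHolds
import Literature.NumberTheory.LFunctions.KowalskiMichelPeterssonFormulaHolds
import Literature.NumberTheory.LFunctions.KMVFirstMomentBeyondDiagonal
import Literature.NumberTheory.EllipticCurves.NewformsFiniteProofs
import HarnessLib

/-!
# Route `PrimeLevelFamEdge`, crux K_A `MomentsBeyondDiagonal` (stmt-Parity-20007), line «petersson_layers» v4: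
# THE DICTIONARY AT `Q = 1`, KERNEL-CHECKED — the mollified second moment `Q^h(P,1)(M)` DE-AUTOMORPHISED EXACTLY
# (lead prover, 2026-08-28; helper `--supports stmt-Parity-20007`)

The registered line cuts `Q^h(P,Q)(q̂^{Δ'})` into the explicit, cusp-form-free pieces `diagPart` / `layer r` (decks
21a–c, `…PrimeLevelFamEdgeIdeaDeltasPeterssonLayers{Split,Heart,Bands}`), whose MEANING rests on the three printed identities
«AFE (KMV (21)–(22)) ∘ Hecke (KMV (10)) ∘ Petersson (Kowalski–Michel p. 312)» — so far asserted in docstrings only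
(«NOT proved: … the three printed identities (docstring only)», deck 21a). At `Q = 1` every one of the three is now a THEOREM of
the tree (`KMV2000.completedL_half_sq_eq_holds` / `kmv2000_eq22_zero_holds`, `KMV2000.kmv2000_lemma31_holds`,
`KowalskiMichel2000.kowalskiMichel2000_peterssonFormula_holds`, reality `KMV2000.kmv2000_p4_real_holds`). This file COMPOSES them
in the kernel:

* §1 `QhPQ_eq_harmonicSum_sq`: for `q` prime, `Q^h(P,Q)(M) = Σʰ_f (Q̃Λ(f) M_P(f))²` — the squared modulus in
  `KMV2000.QhPQ` is a square (every `λ_f(n)` and every `Λ^{(j)}(f,½)` is real); `Q̃Λ(f) = Λ(f,½)` at `Q = 1`.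
* §2 `harmonicSum_heckeLambda_four_eq_sum_pet`: for `1 ≤ mᵢ < q`, `nᵢ ≥ 1`,
  `Σʰ λ_f(n₁)λ_f(n₂)λ_f(m₁)λ_f(m₂) = Σ_{d₁∣(m₁,n₁)} Σ_{d₂∣(m₂,n₂)} Σʰ λ_f(m₁n₁/d₁²)λ_f(m₂n₂/d₂²)` (Hecke (10) twice, below the
  level, then linearity of `Σʰ`).
* §3 `QhPQ_one_eq_tsum_pet` (THE DICTIONARY, exact): for `q` prime and `⌊M⌋ < q`,
  `Q^h(P,1)(M) = 2q̂ Σ'_{(n₁,n₂) ∈ ℕ×ℕ} (n₁n₂)^{−1/2} W(n₁n₂/q̂²) Σ_{m₁,m₂ ≤ M} x_{m₁}x_{m₂} Σ_{d₁∣(m₁,n₁)} Σ_{d₂∣(m₂,n₂)}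
   Σʰ_f λ_f(m₁n₁/d₁²) λ_f(m₂n₂/d₂²)`,
  with `W = KMV2000.cutoffW` (`= afeW q̂ 0 0 n₁ n₂` on `n₁n₂ ≥ 1`, `afeW_zero_zero`), `x_m = KMV2000.mollifierCoeff P M m`, and
  the inner harmonic average = `KowalskiMichel2000.pet q a b = δ(a,b) − J(a,b)` by Petersson's formula
  (`QhPQ_one_eq_tsum_delta_sub_petJ`): NO cusp form, `L`-function or harmonic weight remains on the right-hand side.
  The `n`-series converges absolutely (`summable_dictionaryTermAtOne`).

What this gives the line: the `i = j = 0` slice of `spectralSum` IS the mollified second moment of `L(½,f)` up to the two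
truncations (`nᵢ ≤ q²`, `r ≤ q⁸`) — the remaining content of `stub_identP` at `Q = 1` is only the tail estimate
(`cutoffW ≤ 2e^{−√y}`, Weil). What it does NOT give: anything at `Q ≠ 1` (orders `k ≥ 1` of `kmv2000_eq22` are typed, not proved),
any stub, any moment ASYMPTOTIC, and nothing about `stub_core` / K_A itself (open in print, famE-02). No exceptional-zero statement
(no Landau–Siegel / Siegel-zero exclusion, no GRH) is proved or claimed.
-/

noncomputable section

open scoped MatrixGroups Real
open CongruenceSubgroup Complex Finset Polynomial MeasureTheory
open Literature.NumberTheory.EllipticCurves.ModularForms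
open Literature.NumberTheory.LFunctions

namespace Summit.Parity.GeneralizedHardyLittlewood.Theorems.PrimeLevelFamEdgeIdeaDeltas.PeterssonLayers

/-! ## §0. Small bridges -/

/-- The deck's Mellin–Barnes weight `afeW` (deck 21a §1) IS the Literature one (`KMV2000.afeW`): same body. -/
theorem afeW_eq_kmv (qh : ℝ) (i j n₁ n₂ : ℕ) : afeW qh i j n₁ n₂ = KMV2000.afeW qh i j n₁ n₂ := rfl

/-- At orders `i = j = 0` and `n₁n₂ ≥ 1` the deck's weight is KMV's cut-off `W(n₁n₂/q̂²)` (21) in closed real form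
(`KMV2000.afeW_zero_zero_eq_cutoffW`). -/
theorem afeW_zero_zero (q : ℕ) [NeZero q] {n₁ n₂ : ℕ} (h₁ : n₁ ≠ 0) (h₂ : n₂ ≠ 0) :
    afeW (KMV2000.qhat q) 0 0 n₁ n₂ =
      ((KMV2000.cutoffW ((n₁ : ℝ) * n₂ / KMV2000.qhat q ^ 2) : ℝ) : ℂ) := by
  rw [afeW_eq_kmv]
  exact KMV2000.afeW_zero_zero_eq_cutoffW (KMV2000.qhat_pos_of_neZero q) h₁ h₂

/-- `Q̃Λ(f)(½) = Λ(f,½)` at `Q = 1` (only the `j = 0` term of `KMV2000.Qtilde`). -/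
theorem Qtilde_one (q : ℕ) [NeZero q] (f : CuspForm (Gamma0 q) 2) :
    KMV2000.Qtilde q 1 f = KMV2000.completedL q f (1 / 2) := by
  unfold KMV2000.Qtilde
  simp [KMV2000.derivLambda]

/-- The harmonic average only sees the values on `newforms0 q 2`. -/
theorem harmonicSum_congr_newforms {q : ℕ} [NeZero q] {α β : CuspForm (Gamma0 q) 2 → ℂ}
    (h : ∀ f ∈ newforms0 q 2, α f = β f) :
    GL2Family.harmonicSum q 2 α = GL2Family.harmonicSum q 2 β := by
  unfold GL2Family.harmonicSum
  exact finsum_mem_congr rfl fun f hf ↦ by rw [h f hf]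

/-- `Σʰ` commutes with finite sums of test functions. -/
theorem harmonicSum_finset_sum {q : ℕ} [NeZero q] {ι : Type*} (s : Finset ι) (g : ι → CuspForm (Gamma0 q) 2 → ℂ) :
    GL2Family.harmonicSum q 2 (fun f ↦ ∑ i ∈ s, g i f) = ∑ i ∈ s, GL2Family.harmonicSum q 2 (g i) := by
  classical
  have hfin := finite_newforms0_holds q 2
  unfold GL2Family.harmonicSum
  rw [finsum_mem_eq_finite_toFinset_sum _ hfin]
  simp_rw [finsum_mem_eq_finite_toFinset_sum _ hfin, Finset.mul_sum]
  rw [Finset.sum_comm]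

/-- A complex number with zero imaginary part has `‖z‖² = z²` (as complex numbers). -/
theorem ofReal_norm_sq_eq_sq_of_im {z : ℂ} (hz : z.im = 0) : ((‖z‖ ^ 2 : ℝ) : ℂ) = z ^ 2 := by
  rw [← Complex.re_add_im z, hz]
  simp only [Complex.ofReal_zero, zero_mul, add_zero]
  rw [← Complex.ofReal_pow, Complex.norm_real, Real.norm_eq_abs, sq_abs]

/-! ## §1. Reality: `Q^h(P,Q) = Σʰ (Q̃Λ(f) M_P(f))²` for `q` prime -/

/-- `Q̃Λ(f)(½)` is real for `f ∈ S₂(q)*`, `q` prime (real coefficients of `Q`, real `Λ^{(j)}(f,½)`: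
`KMV2000.kmv2000_p4_real_holds`). -/
theorem im_Qtilde_eq_zero {q : ℕ} [NeZero q] (hq : q.Prime) (Q : ℝ[X]) {f : CuspForm (Gamma0 q) 2}
    (hf : f ∈ newforms0 q 2) : (KMV2000.Qtilde q Q f).im = 0 := by
  unfold KMV2000.Qtilde
  rw [Complex.im_sum]
  refine Finset.sum_eq_zero fun j _ ↦ ?_
  have hd : (KMV2000.derivLambda q j f).im = 0 := (KMV2000.kmv2000_p4_real_holds q hq f hf).2 j
  have hc : ((((Real.log (KMV2000.qhat q))⁻¹ : ℝ) : ℂ) ^ j) =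
      ((((Real.log (KMV2000.qhat q))⁻¹ ^ j : ℝ)) : ℂ) := by push_cast; ring
  rw [hc, mul_assoc, Complex.im_ofReal_mul, Complex.im_ofReal_mul, hd]
  ring

/-- `M_P(f)` is real for `f ∈ S₂(q)*` (real `λ_f(m)`, real coefficients `x_m`). -/
theorem im_mollifierP_eq_zero {q : ℕ} [NeZero q] (P : ℝ[X]) (M : ℝ) {f : CuspForm (Gamma0 q) 2}
    (hf : f ∈ newforms0 q 2) : (KMV2000.mollifierP q P M f).im = 0 := by
  rw [KMV2000.mollifierP_eq_sum_mollifierCoeff, Complex.im_sum]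
  refine Finset.sum_eq_zero fun m _ ↦ ?_
  rw [Complex.mul_im, Complex.ofReal_im, Complex.ofReal_re, KMV2000.heckeLambda_im_eq_zero hf m]
  ring

/-- **§1. `Q^h(P,Q)(M) = Σʰ_f (Q̃Λ(f) M_P(f))²`** for `q` prime: the squared modulus in `KMV2000.QhPQ` is the square,
every factor being real on `S₂(q)*`. -/
theorem QhPQ_eq_harmonicSum_sq {q : ℕ} [NeZero q] (hq : q.Prime) (P Q : ℝ[X]) (M : ℝ) :
    KMV2000.QhPQ q P Q M =
      GL2Family.harmonicSum q 2 (fun f ↦ (KMV2000.Qtilde q Q f * KMV2000.mollifierP q P M f) ^ 2) := by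
  unfold KMV2000.QhPQ
  refine harmonicSum_congr_newforms fun f hf ↦ ?_
  apply ofReal_norm_sq_eq_sq_of_im
  rw [Complex.mul_im, im_Qtilde_eq_zero hq Q hf, im_mollifierP_eq_zero P M hf]
  ring

/-- §1 at `Q = 1`: `Q^h(P,1)(M) = Σʰ_f (Λ(f,½) M_P(f))²`. -/
theorem QhPQ_one_eq_harmonicSum_sq {q : ℕ} [NeZero q] (hq : q.Prime) (P : ℝ[X]) (M : ℝ) :
    KMV2000.QhPQ q P 1 M =
      GL2Family.harmonicSum q 2
        (fun f ↦ (KMV2000.completedL q f (1 / 2) * KMV2000.mollifierP q P M f) ^ 2) := by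
  rw [QhPQ_eq_harmonicSum_sq hq]
  simp_rw [Qtilde_one]

/-! ## §2. Hecke (10) twice below the level, then linearity of `Σʰ` -/

/-- **§2. `Σʰ λ_f(n₁)λ_f(n₂)·λ_f(m₁)λ_f(m₂) = Σ_{d₁∣(m₁,n₁)} Σ_{d₂∣(m₂,n₂)} Σʰ λ_f(m₁n₁/d₁²) λ_f(m₂n₂/d₂²)`** for `q` prime,
`1 ≤ mᵢ < q`, `nᵢ ≥ 1` (KMV (10) with the trivial character void below the level, `KMV2000.heckeLambda_mul_of_lt_level` with
`kmv2000_lemma31_holds`; the inner averages are Kowalski–Michel's `pet q a b`). -/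
theorem harmonicSum_heckeLambda_four_eq_sum_pet {q : ℕ} [NeZero q] (hq : q.Prime) {m₁ m₂ n₁ n₂ : ℕ}
    (hm₁ : 1 ≤ m₁) (hm₁q : m₁ < q) (hm₂ : 1 ≤ m₂) (hm₂q : m₂ < q) (hn₁ : 1 ≤ n₁) (hn₂ : 1 ≤ n₂) :
    GL2Family.harmonicSum q 2 (fun f ↦ GL2Family.heckeLambda f n₁ * GL2Family.heckeLambda f n₂ *
        (GL2Family.heckeLambda f m₁ * GL2Family.heckeLambda f m₂)) =
      ∑ d₁ ∈ (Nat.gcd m₁ n₁).divisors, ∑ d₂ ∈ (Nat.gcd m₂ n₂).divisors,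
        KowalskiMichel2000.pet q (m₁ * n₁ / d₁ ^ 2) (m₂ * n₂ / d₂ ^ 2) := by
  have hH := KMV2000.kmv2000_lemma31_holds
  have step : GL2Family.harmonicSum q 2 (fun f ↦ GL2Family.heckeLambda f n₁ * GL2Family.heckeLambda f n₂ *
        (GL2Family.heckeLambda f m₁ * GL2Family.heckeLambda f m₂)) =
      GL2Family.harmonicSum q 2 (fun f ↦ ∑ d₁ ∈ (Nat.gcd m₁ n₁).divisors, ∑ d₂ ∈ (Nat.gcd m₂ n₂).divisors,
        GL2Family.heckeLambda f (m₁ * n₁ / d₁ ^ 2) * GL2Family.heckeLambda f (m₂ * n₂ / d₂ ^ 2)) := by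
    refine harmonicSum_congr_newforms fun f hf ↦ ?_
    have e₁ := KMV2000.heckeLambda_mul_of_lt_level hH hq hf hm₁ hm₁q hn₁
    have e₂ := KMV2000.heckeLambda_mul_of_lt_level hH hq hf hm₂ hm₂q hn₂
    calc GL2Family.heckeLambda f n₁ * GL2Family.heckeLambda f n₂ *
          (GL2Family.heckeLambda f m₁ * GL2Family.heckeLambda f m₂)
        = (GL2Family.heckeLambda f m₁ * GL2Family.heckeLambda f n₁) *
            (GL2Family.heckeLambda f m₂ * GL2Family.heckeLambda f n₂) := by ring
      _ = (∑ d₁ ∈ (Nat.gcd m₁ n₁).divisors, GL2Family.heckeLambda f (m₁ * n₁ / d₁ ^ 2)) *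
            (∑ d₂ ∈ (Nat.gcd m₂ n₂).divisors, GL2Family.heckeLambda f (m₂ * n₂ / d₂ ^ 2)) := by rw [e₁, e₂]
      _ = _ := by rw [Finset.sum_mul_sum]
  rw [step, harmonicSum_finset_sum]
  refine Finset.sum_congr rfl fun d₁ _ ↦ ?_
  rw [harmonicSum_finset_sum]
  rfl


/-! ## §3. THE DICTIONARY: AFE (`k = 0`) ∘ Hecke ∘ Petersson inside the harmonic average, exact -/

/-- The `(n₁,n₂)`-slice of the dictionary, pointwise: for `q` prime, `⌊M⌋ < q` and every `n ∈ ℕ × ℕ`,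
`Σ_{f ∈ S₂(q)*} ω_f · (2q̂ · [λ_f(n₁)λ_f(n₂)(n₁n₂)^{−1/2}W(n₁n₂/q̂²)] · M_P(f)²)
 = 2q̂ (n₁n₂)^{−1/2} W(n₁n₂/q̂²) Σ_{m₁,m₂ ≤ M} x_{m₁}x_{m₂} Σ_{d₁∣(m₁,n₁)} Σ_{d₂∣(m₂,n₂)} Σʰ λ_f(m₁n₁/d₁²)λ_f(m₂n₂/d₂²)`
(both sides vanish when `n₁n₂ = 0`, the factor `(n₁n₂)^{−1/2}` being `0` there). -/
theorem dictionaryAtOne_slice {q : ℕ} [NeZero q] (hq : q.Prime) (P : ℝ[X]) {M : ℝ} (hM : ⌊M⌋₊ < q)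
    (n : ℕ × ℕ) :
    ∑ f ∈ (finite_newforms0_holds q 2).toFinset, (GL2Family.harmonicWeight f : ℂ) *
        (2 * (KMV2000.qhat q : ℂ) * KMV2000.afeSqTerm q f n * KMV2000.mollifierP q P M f ^ 2) =
      2 * (KMV2000.qhat q : ℂ) *
        (((((n.1 : ℝ) * n.2) ^ (-(1 / 2 : ℝ)) : ℝ) : ℂ) *
          ((KMV2000.cutoffW ((n.1 : ℝ) * n.2 / KMV2000.qhat q ^ 2) : ℝ) : ℂ) *
        ∑ m₁ ∈ Icc 1 ⌊M⌋₊, ∑ m₂ ∈ Icc 1 ⌊M⌋₊,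
          (KMV2000.mollifierCoeff P M m₁ : ℂ) * (KMV2000.mollifierCoeff P M m₂ : ℂ) *
          ∑ d₁ ∈ (Nat.gcd m₁ n.1).divisors, ∑ d₂ ∈ (Nat.gcd m₂ n.2).divisors,
            KowalskiMichel2000.pet q (m₁ * n.1 / d₁ ^ 2) (m₂ * n.2 / d₂ ^ 2)) := by
  have hfin := finite_newforms0_holds q 2
  -- the cusp-form-free factor `c(n) = (n₁n₂)^{-1/2} W(n₁n₂/q̂²)`
  obtain ⟨c, hc⟩ : ∃ c : ℂ, ((((n.1 : ℝ) * n.2) ^ (-(1 / 2 : ℝ)) : ℝ) : ℂ) *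
      ((KMV2000.cutoffW ((n.1 : ℝ) * n.2 / KMV2000.qhat q ^ 2) : ℝ) : ℂ) = c := ⟨_, rfl⟩
  have hterm : ∀ f : CuspForm (Gamma0 q) 2, KMV2000.afeSqTerm q f n =
      c * (GL2Family.heckeLambda f n.1 * GL2Family.heckeLambda f n.2) := by
    intro f
    rw [KMV2000.afeSqTerm, ← hc]
    ring
  -- fold the finite sum back into `Σʰ`
  have hfold : ∑ f ∈ hfin.toFinset, (GL2Family.harmonicWeight f : ℂ) *
        (2 * (KMV2000.qhat q : ℂ) * KMV2000.afeSqTerm q f n * KMV2000.mollifierP q P M f ^ 2) =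
      2 * (KMV2000.qhat q : ℂ) * c * GL2Family.harmonicSum q 2 (fun f ↦
        GL2Family.heckeLambda f n.1 * GL2Family.heckeLambda f n.2 * KMV2000.mollifierP q P M f ^ 2) := by
    unfold GL2Family.harmonicSum
    rw [finsum_mem_eq_finite_toFinset_sum _ hfin, Finset.mul_sum]
    refine Finset.sum_congr rfl fun f _ ↦ ?_
    rw [hterm f]
    ring
  -- open `M_P(f)² = Σ_{m₁,m₂} (λ_f(m₁)x_{m₁})(λ_f(m₂)x_{m₂})`
  have hsq : ∀ f : CuspForm (Gamma0 q) 2,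
      GL2Family.heckeLambda f n.1 * GL2Family.heckeLambda f n.2 * KMV2000.mollifierP q P M f ^ 2 =
        ∑ m₁ ∈ Icc 1 ⌊M⌋₊, ∑ m₂ ∈ Icc 1 ⌊M⌋₊,
          (KMV2000.mollifierCoeff P M m₁ : ℂ) * (KMV2000.mollifierCoeff P M m₂ : ℂ) *
            (GL2Family.heckeLambda f n.1 * GL2Family.heckeLambda f n.2 *
              (GL2Family.heckeLambda f m₁ * GL2Family.heckeLambda f m₂)) := by
    intro f
    rw [KMV2000.mollifierP_eq_sum_mollifierCoeff, sq, Finset.sum_mul_sum, Finset.mul_sum]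
    refine Finset.sum_congr rfl fun m₁ _ ↦ ?_
    rw [Finset.mul_sum]
    refine Finset.sum_congr rfl fun m₂ _ ↦ ?_
    ring
  by_cases h0 : n.1 = 0 ∨ n.2 = 0
  · -- degenerate slice: the factor `(n₁n₂)^{-1/2}` vanishes on both sides
    have hr : (((n.1 : ℝ) * n.2) ^ (-(1 / 2 : ℝ)) : ℝ) = 0 := by
      have hz : ((n.1 : ℝ) * n.2) = 0 := by
        rcases h0 with h | h <;> simp [h]
      rw [hz, Real.zero_rpow (by norm_num)]
    have hc0 : c = 0 := by rw [← hc, hr]; simp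
    rw [hfold, hc0, hr]
    simp
  · rw [not_or] at h0
    have h₁ : 1 ≤ n.1 := Nat.one_le_iff_ne_zero.mpr h0.1
    have h₂ : 1 ≤ n.2 := Nat.one_le_iff_ne_zero.mpr h0.2
    -- push `Σʰ` inside the finite sums and apply §2 (Hecke ∘ Petersson) pair by pair
    have hH : GL2Family.harmonicSum q 2 (fun f ↦
        GL2Family.heckeLambda f n.1 * GL2Family.heckeLambda f n.2 * KMV2000.mollifierP q P M f ^ 2) =
        ∑ m₁ ∈ Icc 1 ⌊M⌋₊, ∑ m₂ ∈ Icc 1 ⌊M⌋₊,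
          (KMV2000.mollifierCoeff P M m₁ : ℂ) * (KMV2000.mollifierCoeff P M m₂ : ℂ) *
          ∑ d₁ ∈ (Nat.gcd m₁ n.1).divisors, ∑ d₂ ∈ (Nat.gcd m₂ n.2).divisors,
            KowalskiMichel2000.pet q (m₁ * n.1 / d₁ ^ 2) (m₂ * n.2 / d₂ ^ 2) := by
      simp_rw [hsq]
      rw [harmonicSum_finset_sum]
      refine Finset.sum_congr rfl fun m₁ hm₁ ↦ ?_
      rw [harmonicSum_finset_sum]
      refine Finset.sum_congr rfl fun m₂ hm₂ ↦ ?_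
      rw [Finset.mem_Icc] at hm₁ hm₂
      rw [GL2Family.harmonicSum_const_mul,
        harmonicSum_heckeLambda_four_eq_sum_pet hq hm₁.1 (lt_of_le_of_lt hm₁.2 hM) hm₂.1
          (lt_of_le_of_lt hm₂.2 hM) h₁ h₂]
    rw [hfold, hH, ← hc]
    ring

/-- Per form: `ω_f (Λ(f,½) M_P(f))² = Σ'_{n} ω_f · (2q̂ · afeSqTerm q f n · M_P(f)²)` and the series converges absolutely
(KMV (21)–(22) at `k = 0`, `KMV2000.completedL_half_sq_eq_holds`, times the constants). -/
theorem hasSum_weight_mul_sq {q : ℕ} [NeZero q] (hq : q.Prime) (P : ℝ[X]) (M : ℝ)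
    {f : CuspForm (Gamma0 q) 2} (hf : f ∈ newforms0 q 2) :
    Summable (fun n : ℕ × ℕ ↦ (GL2Family.harmonicWeight f : ℂ) *
        (2 * (KMV2000.qhat q : ℂ) * KMV2000.afeSqTerm q f n * KMV2000.mollifierP q P M f ^ 2)) ∧
      (GL2Family.harmonicWeight f : ℂ) * (KMV2000.completedL q f (1 / 2) * KMV2000.mollifierP q P M f) ^ 2 =
        ∑' n : ℕ × ℕ, (GL2Family.harmonicWeight f : ℂ) *
          (2 * (KMV2000.qhat q : ℂ) * KMV2000.afeSqTerm q f n * KMV2000.mollifierP q P M f ^ 2) := by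
  obtain ⟨hsum, heq⟩ := KMV2000.completedL_half_sq_eq_holds q hq f hf
  refine ⟨((hsum.mul_left (2 * (KMV2000.qhat q : ℂ))).mul_right
    (KMV2000.mollifierP q P M f ^ 2)).mul_left _, ?_⟩
  rw [mul_pow, heq, ← tsum_mul_left, ← tsum_mul_right, ← tsum_mul_left]

/-- **§3. THE DICTIONARY AT `Q = 1` (exact; AFE ∘ Hecke ∘ Petersson in the kernel).** For `q` prime and a mollifier length
with `⌊M⌋ < q` (so every `m ≤ M` is prime to the level),
`Q^h(P,1)(M) = 2q̂ Σ'_{(n₁,n₂) ∈ ℕ×ℕ} (n₁n₂)^{−1/2} W(n₁n₂/q̂²) Σ_{m₁,m₂ ≤ M} x_{m₁}x_{m₂} Σ_{d₁∣(m₁,n₁)} Σ_{d₂∣(m₂,n₂)}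
  Σʰ_f λ_f(m₁n₁/d₁²) λ_f(m₂n₂/d₂²)`
— the `i = j = 0` slice of the deck's `spectralSum` before truncation, with the harmonic PAIR average `pet q a b` in place of the
kernel `κ(a, b)`; no cusp form is left outside `pet`. -/
theorem QhPQ_one_eq_tsum_pet {q : ℕ} [NeZero q] (hq : q.Prime) (P : ℝ[X]) {M : ℝ} (hM : ⌊M⌋₊ < q) :
    KMV2000.QhPQ q P 1 M =
      ∑' n : ℕ × ℕ, 2 * (KMV2000.qhat q : ℂ) *
        (((((n.1 : ℝ) * n.2) ^ (-(1 / 2 : ℝ)) : ℝ) : ℂ) *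
          ((KMV2000.cutoffW ((n.1 : ℝ) * n.2 / KMV2000.qhat q ^ 2) : ℝ) : ℂ) *
        ∑ m₁ ∈ Icc 1 ⌊M⌋₊, ∑ m₂ ∈ Icc 1 ⌊M⌋₊,
          (KMV2000.mollifierCoeff P M m₁ : ℂ) * (KMV2000.mollifierCoeff P M m₂ : ℂ) *
          ∑ d₁ ∈ (Nat.gcd m₁ n.1).divisors, ∑ d₂ ∈ (Nat.gcd m₂ n.2).divisors,
            KowalskiMichel2000.pet q (m₁ * n.1 / d₁ ^ 2) (m₂ * n.2 / d₂ ^ 2)) := by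
  have hfin := finite_newforms0_holds q 2
  rw [QhPQ_one_eq_harmonicSum_sq hq]
  unfold GL2Family.harmonicSum
  rw [finsum_mem_eq_finite_toFinset_sum _ hfin]
  have hf_each : ∀ f ∈ hfin.toFinset,
      (GL2Family.harmonicWeight f : ℂ) * (KMV2000.completedL q f (1 / 2) * KMV2000.mollifierP q P M f) ^ 2 =
        ∑' n : ℕ × ℕ, (GL2Family.harmonicWeight f : ℂ) *
          (2 * (KMV2000.qhat q : ℂ) * KMV2000.afeSqTerm q f n * KMV2000.mollifierP q P M f ^ 2) :=
    fun f hf ↦ (hasSum_weight_mul_sq hq P M ((Set.Finite.mem_toFinset hfin).mp hf)).2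
  have hg_sum : ∀ f ∈ hfin.toFinset, Summable (fun n : ℕ × ℕ ↦ (GL2Family.harmonicWeight f : ℂ) *
      (2 * (KMV2000.qhat q : ℂ) * KMV2000.afeSqTerm q f n * KMV2000.mollifierP q P M f ^ 2)) :=
    fun f hf ↦ (hasSum_weight_mul_sq hq P M ((Set.Finite.mem_toFinset hfin).mp hf)).1
  rw [Finset.sum_congr rfl hf_each, ← Summable.tsum_finsetSum hg_sum]
  exact tsum_congr fun n ↦ dictionaryAtOne_slice hq P hM n

/-- **Absolute convergence of the dictionary series** (a finite sum of absolutely convergent series). -/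
theorem summable_dictionaryTermAtOne {q : ℕ} [NeZero q] (hq : q.Prime) (P : ℝ[X]) {M : ℝ} (hM : ⌊M⌋₊ < q) :
    Summable (fun n : ℕ × ℕ ↦ 2 * (KMV2000.qhat q : ℂ) *
        (((((n.1 : ℝ) * n.2) ^ (-(1 / 2 : ℝ)) : ℝ) : ℂ) *
          ((KMV2000.cutoffW ((n.1 : ℝ) * n.2 / KMV2000.qhat q ^ 2) : ℝ) : ℂ) *
        ∑ m₁ ∈ Icc 1 ⌊M⌋₊, ∑ m₂ ∈ Icc 1 ⌊M⌋₊,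
          (KMV2000.mollifierCoeff P M m₁ : ℂ) * (KMV2000.mollifierCoeff P M m₂ : ℂ) *
          ∑ d₁ ∈ (Nat.gcd m₁ n.1).divisors, ∑ d₂ ∈ (Nat.gcd m₂ n.2).divisors,
            KowalskiMichel2000.pet q (m₁ * n.1 / d₁ ^ 2) (m₂ * n.2 / d₂ ^ 2))) := by
  have hfin := finite_newforms0_holds q 2
  have hg_sum : ∀ f ∈ hfin.toFinset, Summable (fun n : ℕ × ℕ ↦ (GL2Family.harmonicWeight f : ℂ) *
      (2 * (KMV2000.qhat q : ℂ) * KMV2000.afeSqTerm q f n * KMV2000.mollifierP q P M f ^ 2)) :=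
    fun f hf ↦ (hasSum_weight_mul_sq hq P M ((Set.Finite.mem_toFinset hfin).mp hf)).1
  have h := summable_sum hg_sum
  refine h.congr fun n ↦ ?_
  exact dictionaryAtOne_slice hq P hM n

/-- **The dictionary with Petersson's formula substituted** (Kowalski–Michel p. 312, the tree's theorem
`kowalskiMichel2000_peterssonFormula_holds`): every inner pair average is `δ(a,b) − J(a,b)` with
`J(a,b) = (2π/q) Σ_{r≥1} r⁻¹ S(a,b;qr) J₁(4π√(ab)/(qr)) = Σ'_r layerKernel q r a b` — i.e. the diagonal kernel of `diagPart` minus the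
full layer series of the `layer r`. After this step NO automorphic object remains: `Q^h(P,1)(M)` is an explicit series of
Kloosterman sums, Bessel values, Möbius coefficients and KMV's cut-off `W`. -/
theorem QhPQ_one_eq_tsum_delta_sub_petJ {q : ℕ} [NeZero q] (hq : q.Prime) (P : ℝ[X]) {M : ℝ} (hM : ⌊M⌋₊ < q) :
    KMV2000.QhPQ q P 1 M =
      ∑' n : ℕ × ℕ, 2 * (KMV2000.qhat q : ℂ) *
        (((((n.1 : ℝ) * n.2) ^ (-(1 / 2 : ℝ)) : ℝ) : ℂ) *
          ((KMV2000.cutoffW ((n.1 : ℝ) * n.2 / KMV2000.qhat q ^ 2) : ℝ) : ℂ) *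
        ∑ m₁ ∈ Icc 1 ⌊M⌋₊, ∑ m₂ ∈ Icc 1 ⌊M⌋₊,
          (KMV2000.mollifierCoeff P M m₁ : ℂ) * (KMV2000.mollifierCoeff P M m₂ : ℂ) *
          ∑ d₁ ∈ (Nat.gcd m₁ n.1).divisors, ∑ d₂ ∈ (Nat.gcd m₂ n.2).divisors,
            (diagKernel (m₁ * n.1 / d₁ ^ 2) (m₂ * n.2 / d₂ ^ 2) -
              KowalskiMichel2000.petJ q (m₁ * n.1 / d₁ ^ 2) (m₂ * n.2 / d₂ ^ 2))) := by
  rw [QhPQ_one_eq_tsum_pet hq P hM]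
  refine tsum_congr fun n ↦ ?_
  by_cases h0 : n.1 = 0 ∨ n.2 = 0
  · have hz : ((n.1 : ℝ) * n.2) = 0 := by rcases h0 with h | h <;> simp [h]
    rw [hz, Real.zero_rpow (by norm_num)]
    simp
  · rw [not_or] at h0
    congr 2
    refine Finset.sum_congr rfl fun m₁ hm₁ ↦ ?_
    refine Finset.sum_congr rfl fun m₂ hm₂ ↦ ?_
    rw [Finset.mem_Icc] at hm₁ hm₂
    congr 1
    refine Finset.sum_congr rfl fun d₁ hd₁ ↦ ?_
    refine Finset.sum_congr rfl fun d₂ hd₂ ↦ ?_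
    -- `a = m₁n₁/d₁² ≥ 1`, `b = m₂n₂/d₂² ≥ 1` since `dᵢ² ∣ mᵢnᵢ`
    have ha : 1 ≤ m₁ * n.1 / d₁ ^ 2 := by
      have hd : d₁ ∣ Nat.gcd m₁ n.1 := Nat.dvd_of_mem_divisors hd₁
      have hdd : d₁ ^ 2 ∣ m₁ * n.1 := by
        rw [sq]; exact Nat.mul_dvd_mul (hd.trans (Nat.gcd_dvd_left _ _)) (hd.trans (Nat.gcd_dvd_right _ _))
      have hpos : 0 < m₁ * n.1 := Nat.mul_pos (by omega) (Nat.pos_of_ne_zero h0.1)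
      exact Nat.div_pos (Nat.le_of_dvd hpos hdd) (Nat.pos_of_mem_divisors hd₁ |> fun h ↦ by positivity)
    have hb : 1 ≤ m₂ * n.2 / d₂ ^ 2 := by
      have hd : d₂ ∣ Nat.gcd m₂ n.2 := Nat.dvd_of_mem_divisors hd₂
      have hdd : d₂ ^ 2 ∣ m₂ * n.2 := by
        rw [sq]; exact Nat.mul_dvd_mul (hd.trans (Nat.gcd_dvd_left _ _)) (hd.trans (Nat.gcd_dvd_right _ _))
      have hpos : 0 < m₂ * n.2 := Nat.mul_pos (by omega) (Nat.pos_of_ne_zero h0.2)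
      exact Nat.div_pos (Nat.le_of_dvd hpos hdd) (Nat.pos_of_mem_divisors hd₂ |> fun h ↦ by positivity)
    rw [(KowalskiMichel2000.kowalskiMichel2000_peterssonFormula_holds q hq _ _ ha hb).2, diagKernel]

end Summit.Parity.GeneralizedHardyLittlewood.Theorems.PrimeLevelFamEdgeIdeaDeltas.PeterssonLayers

end
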